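import Summits.BirchSwinnertonDyer.Rank1Residual.SecondDescent.ShaDivisibleFromTwoNonempty
import Summits.BirchSwinnertonDyer.Rank1Residual.Supersingular.DescentLowerBoundLevel
import Literature.NumberTheory.EllipticCurves.Rank1Residual.Typed.CasselsLowerBound
import HarnessLib

/-!
# The typed LOWER half / `BSD(E,3)` on the `#Ш_an = 81` rows from TWO second-descent `NONEMPTY`
# witnesses, `Ш`-level (cell `b2b-bsdres`, CLASS-CLOSURE instrument B-1 `SEL3CT-ALT`, seat cc-eng-4)

HONEST FRAMING (cell `b2b-bsdres`, run/shared/lean/b2b/bsd-rank1-residual/, verbatim in every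
file): the goal of the cell is to DELETE the COMBINATION-SHAPED residual classes of the
Birch–Swinnerton-Dyer formula for ALL analytic-rank `≤ 1` elliptic curves over `ℚ` — "full BSD
formula for every rank `≤ 1` curve in class `C`" assembled STRICTLY from published theorems — so
that the rank-`≤ 1` remainder becomes exactly the CONSTRUCTION-SHAPED classes, which are TYPED
(missing-input `Prop`s), NOT attempted. This is not "finishing BSD". Per-pair certificate
consumers; NOT class theorems; nothing booked (the lane books); X6/X7/X8 stay CONSTRUCTION-SHAPED;
rows named are EVIDENCE pointers. THEOREMS ONLY (no definition, no named fact, no `sorry`).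

## What this file does

`Supersingular/DescentLowerBoundLevel.lean` (additive-p3, p273324) reads the `#Ш_an = 81` rows off
ONE line `81 ∣ #Sel^(9)(E/ℚ)`.  The second `3`-descent instrument B-1 produces that line from TWO
`NONEMPTY(witness)` verdicts on the cubics of an `𝔽₃`-basis `η₁, η₂` of `Sel^(3)(E/ℚ)` (binder-free
chain, SIZING-B1-ASK-SHA81 §2).  This file gives the `Ш`-LEVEL companion route — two divisible
independent classes of `Ш[3]` ⇒ `3⁴ ∣ #Ш = shaOrder` (`SecondDescent/ShaDivisibleFromTwoNonempty`)
⇒ the typed LOWER half `MissingLowerBoundAt W 3` (Cassels–Tate parity,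
`Typed.missingLowerBoundAt_of_casselsTate_of_pow_dvd`) ⇒ `BSD(E,3)` on X8 ∩ {r_an = 0} ∩ {surj(3)}
via Wuthrich's upper half (`Typed.X8.bsdp_of_missingLowerBoundAt_of_surj`):

* `pow_dvd_shaOrder_of_two_divisible` (class-free): the certificate ⇒ `p⁴ ∣ W.shaOrder`;
* `missingLowerBoundAt_of_casselsTate_of_two_divisible` (class-free, `ord_p #Ш_an ≤ 4`);
* `X8.bsdp_three_rankZero_of_casselsTate_of_two_nonempty_of_surj` (the N6 = X8 shape of the
  `B1-ASK-SHA81` rows; `X7`/`X6` analogues are one-line substitutions of the Typed consumers).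

Inputs beyond the pair: GZK, the Cassels–Tate pairing fact, `sha_dvd_analyticSha`,
`hasEntireLFunction_rat` — exactly the named facts of p273324's consumers; nothing new is assumed.
-/

noncomputable section

open scoped Classical

open WeierstrassCurve Literature.NumberTheory.EllipticCurves
open Literature.NumberTheory.EllipticCurves.Rank1Residual
open Literature.NumberTheory.EllipticCurves.Rank1Residual.Typed
open Literature.NumberTheory.EllipticCurves.Wuthrich2014

namespace Summit.BirchSwinnertonDyer.Rank1Residual.SecondDescent

variable (W : WeierstrassCurve ℚ) [W.IsElliptic] (p : ℕ) [hp : Fact p.Prime]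

/-- **`p⁴ ∣ #Ш(E/ℚ)` from two second-descent `NONEMPTY` witnesses** (finite `Ш`, `#Ш[p] = p²`,
classes `c₁ ≠ 0`, `c₂ ∉ ℤ∙c₁` of `Ш[p]`, each a `p`-th multiple `cᵢ = p • dᵢ`), in the `shaOrder`
spelling of the Typed consumers. Class-free; per pair; nothing booked.
[cite: Creutz2014, §1] [cite: SilvermanAEC2009, Thm. X.4.2(a)] -/
theorem pow_dvd_shaOrder_of_two_divisible (hfin : W.ShaFinite)
    (hcard : Nat.card (AddSubgroup.torsionBy W.sha (p : ℤ)) = p ^ 2) {c₁ c₂ d₁ d₂ : W.sha}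
    (h1 : p • c₁ = 0) (h2 : p • c₂ = 0) (hc₁ : c₁ ≠ 0) (hind : c₂ ∉ AddSubgroup.zmultiples c₁)
    (hd₁ : p • d₁ = c₁) (hd₂ : p • d₂ = c₂) : p ^ 4 ∣ W.shaOrder := by
  haveI : Finite W.sha := hfin
  exact pow_four_dvd_card_sha_of_two_divisible W hp.out hcard h1 h2 hc₁ hind hd₁ hd₂

/-- **The typed LOWER half at `p` from two `NONEMPTY` witnesses**, analytic rank `≤ 1`
(`Ш` finite by GZK), `ord_p #Ш_an ≤ 4`: Cassels–Tate parity turns `p³ ∣ #Ш` (⇐ `p⁴ ∣ #Ш`) into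
`MissingLowerBoundAt W p` (`Typed.missingLowerBoundAt_of_casselsTate_of_pow_dvd`, `k = 2`).
Class-free; per pair; nothing booked. [cite: SilvermanAEC2009, Thm. X.4.14] [cite: Creutz2014, §1] -/
theorem missingLowerBoundAt_of_casselsTate_of_two_divisible
    (hCT : exists_casselsTate_pairing (K := ℚ))
    (hGZK : rank_eq_analyticRank_of_analyticRank_le_one) (hr : W.analyticRank ≤ 1)
    (hcard : Nat.card (AddSubgroup.torsionBy W.sha (p : ℤ)) = p ^ 2) {c₁ c₂ d₁ d₂ : W.sha}
    (h1 : p • c₁ = 0) (h2 : p • c₂ = 0) (hc₁ : c₁ ≠ 0) (hind : c₂ ∉ AddSubgroup.zmultiples c₁)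
    (hd₁ : p • d₁ = c₁) (hd₂ : p • d₂ = c₂) {q : ℚ} (hq : shaAn W = (q : ℂ))
    (hv : padicValRat p q ≤ 4) : MissingLowerBoundAt W p := by
  have hfin : W.ShaFinite := (hGZK W hr).2
  have h4 := pow_dvd_shaOrder_of_two_divisible W p hfin hcard h1 h2 hc₁ hind hd₁ hd₂
  exact missingLowerBoundAt_of_casselsTate_of_pow_dvd W p hCT hfin hq (k := 2) (by omega)
    (dvd_trans (pow_dvd_pow p (by norm_num)) h4)

/-- **X8 ∩ {r_an = 0} ∩ {surj(3)}, `ord₃ #Ш_an ≤ 4`: `BSD(E,3)` from PUBLISHED theorems + `#Ш[3] = 9`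
+ TWO second-`3`-descent `NONEMPTY` witnesses on an `𝔽₃`-basis of `Ш[3]`** — the `Ш`-level
twin of additive-p3's `Supersingular.X8.bsdp_three_rankZero_of_card_selmerNine_of_surj` (which
reads the same rows off `81 ∣ #Sel^(9)`). EVIDENCE pointers: class-closure N6's 33 `#Ш_an = 81·u`
cells of `B1-ASK-SHA81` (targets; nothing run; nothing booked).
[cite: Wuthrich2014, Prop. 21 (p. 400)] [cite: SilvermanAEC2009, Thm. X.4.14] [cite: Creutz2014, §1]
[cite: Miller2011LMS, §1 and Def. 1.1] -/
theorem X8.bsdp_three_rankZero_of_casselsTate_of_two_nonempty_of_surj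
    (hCT : exists_casselsTate_pairing (K := ℚ)) (hW : sha_dvd_analyticSha)
    (hGZK : rank_eq_analyticRank_of_analyticRank_le_one) (hmod : hasEntireLFunction_rat)
    (W : WeierstrassCurve ℚ) [W.IsElliptic] [W.IsGloballyMinimal] (hX : ClassX8 W 3) (hs : Surj W 3)
    (hr : W.analyticRank = 0) (hcard : Nat.card (AddSubgroup.torsionBy W.sha (3 : ℤ)) = 9)
    {c₁ c₂ d₁ d₂ : W.sha} (h1 : 3 • c₁ = 0) (h2 : 3 • c₂ = 0) (hc₁ : c₁ ≠ 0)
    (hind : c₂ ∉ AddSubgroup.zmultiples c₁) (hd₁ : 3 • d₁ = c₁) (hd₂ : 3 • d₂ = c₂)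
    {q : ℚ} (hq : shaAn W = (q : ℂ)) (hv : padicValRat 3 q ≤ 4) : BSDp W 3 :=
  haveI : Fact (Nat.Prime 3) := ⟨Nat.prime_three⟩
  X8.bsdp_of_missingLowerBoundAt_of_surj W 3 hW hGZK hmod hX hs hr
    (missingLowerBoundAt_of_casselsTate_of_two_divisible W 3 hCT hGZK (by omega)
      (by rw [show ((3 : ℕ) : ℤ) = 3 by norm_num, hcard]; norm_num) h1 h2 hc₁ hind hd₁ hd₂ hq hv)

/-- **X7 ∩ {r_an = 0}, surj(3) (per-pair datum), `ord₃ #Ш_an ≤ 4`: `BSD(E,3)` from PUBLISHED theorems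
+ `#Ш[3] = 9` + TWO second-`3`-descent `NONEMPTY` witnesses** — the `Ш`-level twin of
`Supersingular.X7.bsdp_three_rankZero_of_card_selmerNine_of_surj` (the X7 11 of `B1-ASK-SHA81`;
EVIDENCE pointers only). Appended (cc-eng-4 GEN 5); per pair; nothing booked.
[cite: Wuthrich2014, Prop. 21 (p. 400)] [cite: SilvermanAEC2009, Thm. X.4.14] [cite: Creutz2014, §1]
[cite: Miller2011LMS, §1 and Def. 1.1] -/
theorem X7.bsdp_three_rankZero_of_casselsTate_of_two_nonempty_of_surj
    (hCT : exists_casselsTate_pairing (K := ℚ)) (hW : sha_dvd_analyticSha)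
    (hGZK : rank_eq_analyticRank_of_analyticRank_le_one) (hmod : hasEntireLFunction_rat)
    (W : WeierstrassCurve ℚ) [W.IsElliptic] [W.IsGloballyMinimal] (hX : ClassX7 W 3) (hs : Surj W 3)
    (hr : W.analyticRank = 0) (hcard : Nat.card (AddSubgroup.torsionBy W.sha (3 : ℤ)) = 9)
    {c₁ c₂ d₁ d₂ : W.sha} (h1 : 3 • c₁ = 0) (h2 : 3 • c₂ = 0) (hc₁ : c₁ ≠ 0)
    (hind : c₂ ∉ AddSubgroup.zmultiples c₁) (hd₁ : 3 • d₁ = c₁) (hd₂ : 3 • d₂ = c₂)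
    {q : ℚ} (hq : shaAn W = (q : ℂ)) (hv : padicValRat 3 q ≤ 4) : BSDp W 3 :=
  haveI : Fact (Nat.Prime 3) := ⟨Nat.prime_three⟩
  X7.bsdp_of_missingLowerBoundAt_of_surj W 3 hW hGZK hmod (by norm_num) hX hs hr
    (missingLowerBoundAt_of_casselsTate_of_two_divisible W 3 hCT hGZK (by omega)
      (by rw [show ((3 : ℕ) : ℤ) = 3 by norm_num, hcard]; norm_num) h1 h2 hc₁ hind hd₁ hd₂ hq hv)

/-- **X6 ∩ {r_an = 0}, `ord₃ #Ш_an ≤ 4`: `BSD(E,3)` from PUBLISHED theorems + `#Ш[3] = 9` + TWO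
second-`3`-descent `NONEMPTY` witnesses** (image proviso automatic for X6) — the `Ш`-level twin of
`Supersingular.X6.bsdp_three_rankZero_of_card_selmerNine`; the three X6 rows of `B1-ASK-SHA81`
(`152330l1 271726d1 405130d1` = the N4@3 canary of 08-22 item (8)) are its EVIDENCE pointers
(nothing run, nothing booked). Appended (cc-eng-4 GEN 5); per pair.
[cite: Wuthrich2014, Prop. 21 (p. 400)] [cite: SilvermanAEC2009, Thm. X.4.14] [cite: Creutz2014, §1]
[cite: Miller2011LMS, §1 and Def. 1.1] -/
theorem X6.bsdp_three_rankZero_of_casselsTate_of_two_nonempty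
    (hCT : exists_casselsTate_pairing (K := ℚ)) (hW : sha_dvd_analyticSha)
    (hGZK : rank_eq_analyticRank_of_analyticRank_le_one) (hmod : hasEntireLFunction_rat)
    (W : WeierstrassCurve ℚ) [W.IsElliptic] [W.IsGloballyMinimal] (hX : ClassX6 W 3)
    (hr : W.analyticRank = 0) (hcard : Nat.card (AddSubgroup.torsionBy W.sha (3 : ℤ)) = 9)
    {c₁ c₂ d₁ d₂ : W.sha} (h1 : 3 • c₁ = 0) (h2 : 3 • c₂ = 0) (hc₁ : c₁ ≠ 0)
    (hind : c₂ ∉ AddSubgroup.zmultiples c₁) (hd₁ : 3 • d₁ = c₁) (hd₂ : 3 • d₂ = c₂)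
    {q : ℚ} (hq : shaAn W = (q : ℂ)) (hv : padicValRat 3 q ≤ 4) : BSDp W 3 :=
  haveI : Fact (Nat.Prime 3) := ⟨Nat.prime_three⟩
  X6.bsdp_of_missingLowerBoundAt_of_analyticRank_eq_zero W 3 hW hGZK hmod (by norm_num) hX hr
    (missingLowerBoundAt_of_casselsTate_of_two_divisible W 3 hCT hGZK (by omega)
      (by rw [show ((3 : ℕ) : ℤ) = 3 by norm_num, hcard]; norm_num) h1 h2 hc₁ hind hd₁ hd₂ hq hv)


/-! ## Appendix (cc-eng-4 GEN 11, 2026-08-21): `hcard`-FREE forms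

`SecondDescent/ShaDivisibleFromTwoNonempty.lean`'s GEN 11 appendix proves `p⁴ ∣ #Ш` from the two
witnesses ALONE (`pow_four_dvd_card_sha_of_two_divisible'`: `#⟨c₁, c₂⟩ = p²` holds for any two
`p`-torsion classes `c₁ ≠ 0`, `c₂ ∉ ℤ∙c₁`, so `#Ш[p] = p²` is not needed).  The primed theorems below
are the theorems above with the binder `hcard : #Ш[p] = p²` (`#Ш[3] = 9`) DELETED and nothing
else changed.  What this buys a B-1 `NONEMPTY × 2` record: its certificate-shaped binders are
exactly the two second-descent witnesses (classes nonzero / independent / `3`-torsion / third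
multiples) + the analytic data — NO EXACT upper bound on `dim Sel₃(E/ℚ)` (the step that needs a
certified class group of the `3`-division octic field) is consumed any more; the front end may
run at GRH grade and every remaining check is exact.  Appended; decls above byte-identical; per
pair; classes unchanged; nothing booked.
-/

/-- **`p⁴ ∣ #Ш(E/ℚ)` from two second-descent `NONEMPTY` witnesses, `hcard`-FREE** (finite `Ш`,
classes `c₁ ≠ 0`, `c₂ ∉ ℤ∙c₁` with `p • cᵢ = 0`, each a `p`-th multiple `cᵢ = p • dᵢ`; NO
hypothesis on `#Ш[p]`), `shaOrder` spelling. Class-free; per pair; nothing booked; cc-eng-4 GEN 11.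
[cite: Creutz2014, §1] [cite: SilvermanAEC2009, Thm. X.4.2(a)] -/
theorem pow_dvd_shaOrder_of_two_divisible' (hfin : W.ShaFinite) {c₁ c₂ d₁ d₂ : W.sha}
    (h1 : p • c₁ = 0) (h2 : p • c₂ = 0) (hc₁ : c₁ ≠ 0) (hind : c₂ ∉ AddSubgroup.zmultiples c₁)
    (hd₁ : p • d₁ = c₁) (hd₂ : p • d₂ = c₂) : p ^ 4 ∣ W.shaOrder := by
  haveI : Finite W.sha := hfin
  exact pow_four_dvd_card_sha_of_two_divisible' W hp.out h1 h2 hc₁ hind hd₁ hd₂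

/-- **The typed LOWER half at `p` from two `NONEMPTY` witnesses, `hcard`-FREE**, analytic rank
`≤ 1` (`Ш` finite by GZK), `ord_p #Ш_an ≤ 4`: Cassels–Tate parity turns `p³ ∣ #Ш` (⇐ `p⁴ ∣ #Ш`)
into `MissingLowerBoundAt W p`. NO hypothesis on `#Ш[p]`. Class-free; per pair; nothing booked;
cc-eng-4 GEN 11. [cite: SilvermanAEC2009, Thm. X.4.14] [cite: Creutz2014, §1] -/
theorem missingLowerBoundAt_of_casselsTate_of_two_divisible'
    (hCT : exists_casselsTate_pairing (K := ℚ))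
    (hGZK : rank_eq_analyticRank_of_analyticRank_le_one) (hr : W.analyticRank ≤ 1)
    {c₁ c₂ d₁ d₂ : W.sha} (h1 : p • c₁ = 0) (h2 : p • c₂ = 0) (hc₁ : c₁ ≠ 0)
    (hind : c₂ ∉ AddSubgroup.zmultiples c₁) (hd₁ : p • d₁ = c₁) (hd₂ : p • d₂ = c₂) {q : ℚ}
    (hq : shaAn W = (q : ℂ)) (hv : padicValRat p q ≤ 4) : MissingLowerBoundAt W p := by
  have hfin : W.ShaFinite := (hGZK W hr).2
  have h4 := pow_dvd_shaOrder_of_two_divisible' W p hfin h1 h2 hc₁ hind hd₁ hd₂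
  exact missingLowerBoundAt_of_casselsTate_of_pow_dvd W p hCT hfin hq (k := 2) (by omega)
    (dvd_trans (pow_dvd_pow p (by norm_num)) h4)

/-- **X8 ∩ {r_an = 0} ∩ {surj(3)}, `ord₃ #Ш_an ≤ 4`: `BSD(E,3)` from PUBLISHED theorems + TWO
second-`3`-descent `NONEMPTY` witnesses — `hcard`-FREE** (= `X8.bsdp_three_rankZero_of_casselsTate_of_two_nonempty_of_surj`
without `#Ш[3] = 9`). Per pair; class X8 unchanged; nothing booked; cc-eng-4 GEN 11.
[cite: Wuthrich2014, Prop. 21 (p. 400)] [cite: SilvermanAEC2009, Thm. X.4.14] [cite: Creutz2014, §1]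
[cite: Miller2011LMS, §1 and Def. 1.1] -/
theorem X8.bsdp_three_rankZero_of_casselsTate_of_two_nonempty_of_surj'
    (hCT : exists_casselsTate_pairing (K := ℚ)) (hW : sha_dvd_analyticSha)
    (hGZK : rank_eq_analyticRank_of_analyticRank_le_one) (hmod : hasEntireLFunction_rat)
    (W : WeierstrassCurve ℚ) [W.IsElliptic] [W.IsGloballyMinimal] (hX : ClassX8 W 3) (hs : Surj W 3)
    (hr : W.analyticRank = 0) {c₁ c₂ d₁ d₂ : W.sha} (h1 : 3 • c₁ = 0) (h2 : 3 • c₂ = 0)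
    (hc₁ : c₁ ≠ 0) (hind : c₂ ∉ AddSubgroup.zmultiples c₁) (hd₁ : 3 • d₁ = c₁) (hd₂ : 3 • d₂ = c₂)
    {q : ℚ} (hq : shaAn W = (q : ℂ)) (hv : padicValRat 3 q ≤ 4) : BSDp W 3 :=
  haveI : Fact (Nat.Prime 3) := ⟨Nat.prime_three⟩
  X8.bsdp_of_missingLowerBoundAt_of_surj W 3 hW hGZK hmod hX hs hr
    (missingLowerBoundAt_of_casselsTate_of_two_divisible' W 3 hCT hGZK (by omega) h1 h2 hc₁ hind
      hd₁ hd₂ hq hv)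

/-- **X7 ∩ {r_an = 0}, surj(3) (per-pair datum), `ord₃ #Ш_an ≤ 4`: `BSD(E,3)` from PUBLISHED theorems
+ TWO second-`3`-descent `NONEMPTY` witnesses — `hcard`-FREE** (= `X7.…_of_two_nonempty_of_surj`
without `#Ш[3] = 9`). Per pair; class X7 unchanged; nothing booked; cc-eng-4 GEN 11.
[cite: Wuthrich2014, Prop. 21 (p. 400)] [cite: SilvermanAEC2009, Thm. X.4.14] [cite: Creutz2014, §1]
[cite: Miller2011LMS, §1 and Def. 1.1] -/
theorem X7.bsdp_three_rankZero_of_casselsTate_of_two_nonempty_of_surj'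
    (hCT : exists_casselsTate_pairing (K := ℚ)) (hW : sha_dvd_analyticSha)
    (hGZK : rank_eq_analyticRank_of_analyticRank_le_one) (hmod : hasEntireLFunction_rat)
    (W : WeierstrassCurve ℚ) [W.IsElliptic] [W.IsGloballyMinimal] (hX : ClassX7 W 3) (hs : Surj W 3)
    (hr : W.analyticRank = 0) {c₁ c₂ d₁ d₂ : W.sha} (h1 : 3 • c₁ = 0) (h2 : 3 • c₂ = 0)
    (hc₁ : c₁ ≠ 0) (hind : c₂ ∉ AddSubgroup.zmultiples c₁) (hd₁ : 3 • d₁ = c₁) (hd₂ : 3 • d₂ = c₂)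
    {q : ℚ} (hq : shaAn W = (q : ℂ)) (hv : padicValRat 3 q ≤ 4) : BSDp W 3 :=
  haveI : Fact (Nat.Prime 3) := ⟨Nat.prime_three⟩
  X7.bsdp_of_missingLowerBoundAt_of_surj W 3 hW hGZK hmod (by norm_num) hX hs hr
    (missingLowerBoundAt_of_casselsTate_of_two_divisible' W 3 hCT hGZK (by omega) h1 h2 hc₁ hind
      hd₁ hd₂ hq hv)

/-- **X6 ∩ {r_an = 0}, `ord₃ #Ш_an ≤ 4`: `BSD(E,3)` from PUBLISHED theorems + TWO second-`3`-descent
`NONEMPTY` witnesses — `hcard`-FREE** (= `X6.bsdp_three_rankZero_of_casselsTate_of_two_nonempty`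
without `#Ш[3] = 9`; image proviso automatic for X6). EVIDENCE pointers: the N4@3 canary
`152330l1 271726d1 405130d1` (records `bsdp3_b1n_·`, p305257). Per pair; class X6 unchanged;
nothing booked; cc-eng-4 GEN 11. [cite: Wuthrich2014, Prop. 21 (p. 400)]
[cite: SilvermanAEC2009, Thm. X.4.14] [cite: Creutz2014, §1] [cite: Miller2011LMS, §1 and Def. 1.1] -/
theorem X6.bsdp_three_rankZero_of_casselsTate_of_two_nonempty'
    (hCT : exists_casselsTate_pairing (K := ℚ)) (hW : sha_dvd_analyticSha)
    (hGZK : rank_eq_analyticRank_of_analyticRank_le_one) (hmod : hasEntireLFunction_rat)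
    (W : WeierstrassCurve ℚ) [W.IsElliptic] [W.IsGloballyMinimal] (hX : ClassX6 W 3)
    (hr : W.analyticRank = 0) {c₁ c₂ d₁ d₂ : W.sha} (h1 : 3 • c₁ = 0) (h2 : 3 • c₂ = 0)
    (hc₁ : c₁ ≠ 0) (hind : c₂ ∉ AddSubgroup.zmultiples c₁) (hd₁ : 3 • d₁ = c₁) (hd₂ : 3 • d₂ = c₂)
    {q : ℚ} (hq : shaAn W = (q : ℂ)) (hv : padicValRat 3 q ≤ 4) : BSDp W 3 :=
  haveI : Fact (Nat.Prime 3) := ⟨Nat.prime_three⟩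
  X6.bsdp_of_missingLowerBoundAt_of_analyticRank_eq_zero W 3 hW hGZK hmod (by norm_num) hX hr
    (missingLowerBoundAt_of_casselsTate_of_two_divisible' W 3 hCT hGZK (by omega) h1 h2 hc₁ hind
      hd₁ hd₂ hq hv)

end Summit.BirchSwinnertonDyer.Rank1Residual.SecondDescent

end
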